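import Summits.QuantumFields.QCD.Theses.TransparentRPWall
import Summits.QuantumFields.QCD.Theorems.TransparentRPWallLabelledConeDiscSections
import Summits.QuantumFields.QCD.Theorems.TransparentRPWallLabelledConeChainDensity
import Summits.QuantumFields.QCD.Theorems.TransparentRPWallLabelledPlanarSpectralConeSplit
import HarnessLib

/-!
# Route `TransparentRPWall` (QCD): `LabelledPlanarSpectralCone` (stmt-QuantumFields-9910) holds

THE LABELLED PLANAR SPECTRAL CONE — for a labelled Schwinger family over ANY label type on `ℝ⁴` with E0', E3, translations on
`⁰𝒮` and reflection positivity in pull-back form for the eight frames of the `(x₀,x₁)`-plane, the two-variable matrix elements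
`(t,b) ↦ 𝔖_{n+m}^{rev k ++ k'}(ΘF* ⊗ G_{te₀+be₁})` extend to holomorphic contraction families on `{|Im β| < Re ζ}`
(`spec(H,P₁) ⊂ {E ≥ |p₁|}` on the OS space of all species).  By name, from the crux-strategist's split
`LabelledPlanarSpectralConeSplit.LabelledPlanarSpectralCone_of_subs` applied to the two landed pieces
`LabelledConeDiscSectionsProof.labelledConeDiscSections_proof` (X₁) and
`LabelledConeChainDensityProof.labelledConeChainDensity_proof` (X₂) — the strategist's complete proof
(planner-cstrat-stmt-QuantumFields-9910-r1-0, 2026-08-17, tree `Cruxes/LabelledPlanarSpectralCone/Proof.lean`), landed verbatim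
in route-independent parts by width seat ym-t4-w17 g0.  The item is the labelled twin of the PROVED one-species
`MirrorModularBoosts.PlanarSpectralCone` (stmt-QuantumFields-9664).  No summit or leg statement is proved; the other cruxes of
route `TransparentRPWall` remain open.
-/

set_option autoImplicit false

namespace Summit.QuantumFields.QCD.Theorems

/-- **Item stmt-QuantumFields-9910 `TransparentRPWall.LabelledPlanarSpectralCone` holds.** [folklore] -/
theorem transparentRPWall_labelledPlanarSpectralCone_proof :
    Summit.QuantumFields.QCD.Theses.TransparentRPWall.LabelledPlanarSpectralCone :=
  LabelledPlanarSpectralConeSplit.LabelledPlanarSpectralCone_of_subs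
    LabelledConeDiscSectionsProof.labelledConeDiscSections_proof
    LabelledConeChainDensityProof.labelledConeChainDensity_proof

end Summit.QuantumFields.QCD.Theorems
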